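import Literature.AlgebraicGeometry.Resolution.PermissibleCentreRegularHost
import Literature.AlgebraicGeometry.Resolution.RegularCentreRsopGenerated
import Literature.AlgebraicGeometry.Resolution.RegularCentreComponents
import Literature.AlgebraicGeometry.Resolution.OrderSemicontinuityPointwise
import Literature.AlgebraicGeometry.Resolution.BlowupChartMembership
import Literature.AlgebraicGeometry.Resolution.BoundarySplitting
import Literature.AlgebraicGeometry.Resolution.MarkedIdealsLemmas
import HarnessLib

/-!
# Crux `PatchingRelPerfect` (stmt-ResolutionOfSingularities-16161), chain W5.2 — TargetsF5 T5-E
# «W₂B-maxweight», piece analysis: the MAX-WEIGHT of a centre component, its permissibility, the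
# pointwise max-weight clause, and the REGULAR HOST along a weight-one component

[OURS · L1 W5.2 · TargetsF5 T5-E support] res-L1-w52-plan-1 g7 DEAL 06:48:30Z / STEER (TargetsF5)
07:30:46Z / HOLD → v4 07:46:31Z. Fact-free; NOT statements of the manuscript under review. The E-side
driver of the mixed engine transports a locally principal `𝔟` along the Cossart–Jannsen–Saito sequence
(F-32bR, `IsBPermissibleSequenceB`) with every CJS centre SPLIT into its irreducible (= connected, the centre
being regular) components `Z` (tree `Kollar2007.boundaryPieces`, `IsBlowup.exists_comp_eq_of_isPiecePartition_cons`
— res-type-002) and each component blown up with the MAXIMAL admissible weight. This file is the per-component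
analysis on the base scheme:

* `pieceWeight 𝔟 Z ∈ {1, 2}` — `2` iff `2 ≤ ord_y 𝔟` at EVERY point `y` of `Z` (non-closed points included), else `1`;
  `le_vanishingIdeal_pow_pieceWeight` — PERMISSIBILITY `𝔟 ≤ 𝓘(Z) ^ pieceWeight 𝔟 Z` for `Z ⊆ Supp 𝔟` with `V(𝓘(Z))`
  regular on a regular locally Noetherian scheme (BGMW Lemma 3.2.1 (1) for regular centres, tree
  `le_pow_of_isRegular_subscheme_of_forall_le_idealOrder_of_isRegular` — ordinary = symbolic powers);
* `idealOrder_genericPoint_le_one_of_pieceWeight_eq_one` — at a weight-ONE component the order at the generic point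
  `η` is `≤ 1` (order does not decrease under specialization, `idealOrder_le_of_specializes`);
* `not_stalkIdeal_le_centre_sq` — the POINTWISE MAX-WEIGHT clause of `IsWeightedSeqB`: if `ord_η 𝔟 ≤ 1` then at
  every `z ∈ Z = cl{η}`, `𝔟_z ⊄ (𝓘(Z)_z)²` (localize at `η`: `𝓘(Z)_z 𝒪_η = 𝔪_η`);
* `idealOrder_le_of_mul` — `ord (𝓗·M) ≤ 1 ⇒ ord 𝓗 ≤ 1` (host order at the generic point);
* `exists_regular_host_generator` — THE REGULAR HOST along a weight-one component: with `𝓗` an effective Cartier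
  host (`Supp 𝓗 = X_j`, so `√𝓗 = 𝓘(X_j)`), `ord_η 𝓗 ≤ 1`, and the CJS permissibility of the centre at `z` (stated for
  `𝓘(X_j) = 𝓘(Supp 𝓗)`), there is a generator `h` of `𝓗_z` with `h ∈ 𝓘(Z)_z` and `h ∉ 𝔪_z²`
  (`not_stalkIdeal_le_sq_of_isPermissible`, `PermissibleCentreRegularHost.lean`: Bennett's criterion along the
  permissible centre).

AI-written; AI review is weaker than expert review.

## References
* E. Bierstone, D. Grigoriev, P. Milman, J. Włodarczyk, arXiv:1206.3090, Def. 3.1.3, Lemma 3.2.1 (1).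
  [BierstoneGrigorievMilmanWlodarczyk2011]
* V. Cossart, U. Jannsen, S. Saito, LNM 2270 (2020), Def. 3.1, Thm. 3.3, Def. 6.8. [CossartJannsenSaito2020]
* J. Kollár, *Lectures on Resolution of Singularities* (2007), 3.30.2. [Kollar2007]
-/

-- `Summit.<Summit>.<Sub>.Theorems` with `Sub = Summit` (single-conjunct summit, D-0017)
set_option linter.dupNamespace false

noncomputable section

open CategoryTheory CategoryTheory.Limits AlgebraicGeometry TopologicalSpace IsLocalRing
open Literature.AlgebraicGeometry.Resolution Scheme.IdealSheafData

namespace Summit.ResolutionOfSingularities.ResolutionOfSingularities.Theorems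

universe u

namespace WeightTwoB

variable {X : Scheme.{u}}

/-! ## §1 The max-weight of a centre component and its permissibility -/

open Classical in
/-- [OURS · L1 W5.2] **The maximal admissible weight (capped at `2`) of the centre component `Z` for `𝔟`**: `2` if
`2 ≤ ord_y 𝔟` at every point `y ∈ Z` (then `𝔟 ≤ 𝓘(Z)²` on a regular scheme), else `1`.
[cite: BierstoneGrigorievMilmanWlodarczyk2011, Def. 3.1.3 (1)] -/
def pieceWeight (𝔟 : X.IdealSheafData) (Z : Set X) : ℕ :=
  if ∀ y ∈ Z, (2 : ℕ∞) ≤ idealOrder 𝔟 y then 2 else 1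

/-- `1 ≤ pieceWeight`. [folklore] -/
theorem one_le_pieceWeight (𝔟 : X.IdealSheafData) (Z : Set X) : 1 ≤ pieceWeight 𝔟 Z := by
  unfold pieceWeight
  split_ifs <;> omega

/-- `pieceWeight ≤ 2`. [folklore] -/
theorem pieceWeight_le_two (𝔟 : X.IdealSheafData) (Z : Set X) : pieceWeight 𝔟 Z ≤ 2 := by
  unfold pieceWeight
  split_ifs <;> omega

/-- `pieceWeight = 2` iff `2 ≤ ord_y 𝔟` along `Z`. [folklore] -/
theorem pieceWeight_eq_two_iff (𝔟 : X.IdealSheafData) (Z : Set X) :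
    pieceWeight 𝔟 Z = 2 ↔ ∀ y ∈ Z, (2 : ℕ∞) ≤ idealOrder 𝔟 y := by
  unfold pieceWeight
  split_ifs with h
  · exact ⟨fun _ => h, fun _ => rfl⟩
  · exact ⟨fun h1 => absurd h1 (by omega), fun h' => absurd h' h⟩

/-- `pieceWeight = 1` iff some point of `Z` has `ord_y 𝔟 ≤ 1`. [folklore] -/
theorem pieceWeight_eq_one_iff (𝔟 : X.IdealSheafData) (Z : Set X) :
    pieceWeight 𝔟 Z = 1 ↔ ∃ y ∈ Z, idealOrder 𝔟 y ≤ 1 := by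
  unfold pieceWeight
  split_ifs with h
  · refine ⟨fun h2 => absurd h2 (by omega), fun ⟨y, hy, hy1⟩ => ?_⟩
    have h2 := h y hy
    have : (2 : ℕ∞) ≤ 1 := h2.trans hy1
    exact absurd this (by decide)
  · refine ⟨fun _ => ?_, fun _ => rfl⟩
    simp only [not_forall, not_le, exists_prop] at h
    obtain ⟨y, hy, hlt⟩ := h
    refine ⟨y, hy, ?_⟩
    exact (ENat.lt_add_one_iff ENat.one_ne_top).mp (by simpa only [show (2 : ℕ∞) = 1 + 1 from rfl] using hlt)

/-- If the weight is `< 2` it is `1`. [folklore] -/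
theorem pieceWeight_lt_two_iff (𝔟 : X.IdealSheafData) (Z : Set X) :
    pieceWeight 𝔟 Z < 2 ↔ pieceWeight 𝔟 Z = 1 := by
  have h1 := one_le_pieceWeight 𝔟 Z
  have h2 := pieceWeight_le_two 𝔟 Z
  omega

/-- **PERMISSIBILITY with the max-weight**: on a regular locally Noetherian scheme, for a closed `Z ⊆ Supp 𝔟` whose
reduced subscheme `V(𝓘(Z))` is regular, `𝔟 ≤ 𝓘(Z) ^ pieceWeight 𝔟 Z` (ordinary = symbolic powers along a regular
centre). [cite: BierstoneGrigorievMilmanWlodarczyk2011, Lemma 3.2.1 (1)] [cite: Kollar2007, 3.30.2] -/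
theorem le_vanishingIdeal_pow_pieceWeight [IsLocallyNoetherian X] (hX : Scheme.IsRegular X)
    {𝔟 : X.IdealSheafData} {Z : Closeds X} (hZ : Scheme.IsRegular (vanishingIdeal Z).subscheme)
    (hsupp : (Z : Set X) ⊆ 𝔟.support) :
    𝔟 ≤ vanishingIdeal Z ^ pieceWeight 𝔟 (Z : Set X) := by
  refine le_pow_of_isRegular_subscheme_of_forall_le_idealOrder_of_isRegular hX hZ fun y hy => ?_
  have hy' : y ∈ (Z : Set X) := by
    rw [← Scheme.IdealSheafData.coe_support_vanishingIdeal Z]; exact hy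
  by_cases h : ∀ y ∈ (Z : Set X), (2 : ℕ∞) ≤ idealOrder 𝔟 y
  · rw [(pieceWeight_eq_two_iff 𝔟 _).mpr h]
    exact h y hy'
  · rw [show pieceWeight 𝔟 (Z : Set X) = 1 from by unfold pieceWeight; rw [if_neg h], Nat.cast_one,
      one_le_idealOrder_iff]
    exact hsupp hy'

/-! ## §2 Weight one: the generic order and the pointwise max-weight clause -/

/-- **At a weight-one component the generic order is at most one**: if `pieceWeight 𝔟 Z = 1` and `η` is a generic
point of `Z` (`cl{η} = Z`) on a scheme with regular local rings, then `ord_η 𝔟 ≤ 1`.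
[cite: BierstoneGrigorievMilmanWlodarczyk2011, §3.1] -/
theorem idealOrder_genericPoint_le_one_of_pieceWeight_eq_one (hX : Scheme.IsRegular X)
    {𝔟 : X.IdealSheafData} {Z : Set X} {η : X} (hη : IsGenericPoint η Z)
    (h1 : pieceWeight 𝔟 Z = 1) : idealOrder 𝔟 η ≤ 1 := by
  obtain ⟨y, hy, hy1⟩ := (pieceWeight_eq_one_iff 𝔟 Z).mp h1
  haveI := hX y
  have hsp : η ⤳ y := (isGenericPoint_iff_specializes.mp hη y).mpr hy
  exact (idealOrder_le_of_specializes hsp 𝔟).trans hy1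

/-- **The POINTWISE MAX-WEIGHT clause** (F5 `IsWeightedSeqB`, weight-deficient steps): if `ord_η 𝔟 ≤ 1` at the
generic point `η` of the centre component through `z` and the centre's stalk at `z` is the prime of `η`
(`C_z = 𝔭_η`), then `𝔟_z ⊄ C_z²` — localizing at `η` turns `C_z` into `𝔪_η`. [folklore] -/
theorem not_stalkIdeal_le_centre_sq {𝔟 C : X.IdealSheafData} {η z : X} (hηz : η ⤳ z)
    (hCz : stalkIdeal C z = primeOfSpecializes hηz) (hord : idealOrder 𝔟 η ≤ 1) :
    ¬ stalkIdeal 𝔟 z ≤ stalkIdeal C z ^ 2 := by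
  intro hle
  have h2 : stalkIdeal 𝔟 η ≤ maximalIdeal (X.presheaf.stalk η) ^ 2 := by
    rw [← stalkIdeal_map_stalkSpecializes 𝔟 hηz]
    refine (Ideal.map_mono hle).trans ?_
    rw [hCz, Ideal.map_pow]
    exact Ideal.pow_right_mono Ideal.map_comap_le 2
  have h3 : (2 : ℕ∞) ≤ idealOrder 𝔟 η := (le_idealOrder_iff 𝔟 η 2).mpr h2
  have : (2 : ℕ∞) ≤ 1 := h3.trans hord
  exact absurd this (by decide)

/-- `ord_x (𝓗 · M) ≤ 1 ⇒ ord_x 𝓗 ≤ 1` (a factor has order at most that of the product).  [folklore] -/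
theorem idealOrder_le_one_of_mul {𝓗 M : X.IdealSheafData} {x : X} (h : idealOrder (𝓗 * M) x ≤ 1) :
    idealOrder 𝓗 x ≤ 1 := by
  by_contra hlt
  rw [not_le] at hlt
  have h2 : ((2 : ℕ) : ℕ∞) ≤ idealOrder 𝓗 x := by
    have := Order.add_one_le_of_lt hlt
    exact_mod_cast this
  rw [le_idealOrder_iff] at h2
  have h2' : ((2 : ℕ) : ℕ∞) ≤ idealOrder (𝓗 * M) x := by
    rw [le_idealOrder_iff, stalkIdeal_mul]
    exact Ideal.mul_le_right.trans h2
  have : (2 : ℕ∞) ≤ 1 := h2'.trans h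
  exact absurd this (by decide)

/-! ## §3 The regular host along a weight-one component -/

/-- **THE REGULAR HOST along a weight-one centre component** (Bennett along a CJS-permissible centre,
`not_stalkIdeal_le_sq_of_isPermissible`). Let `𝓗` be an effective Cartier «host» on a scheme whose local rings at
`z` and `η` are regular, `η ⤳ z` with `C_z = 𝔭_η` (the centre component through `z` is `cl{η}`), `η ∈ Supp 𝓗` with
`ord_η 𝓗 ≤ 1`, and suppose the centre is PERMISSIBLE at `z` for the reduced zero-scheme `V(𝓘(Supp 𝓗))` of the host
(CJS Def. 3.1, the per-step clause `hperm` of `IsBPermissibleSequenceB` with `𝓘(X_j) = 𝓘(Supp 𝓗)`). Then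
`𝓗_z = (h)` with `h ∈ C_z` and `h ∉ 𝔪_z²`. [cite: CossartJannsenSaito2020, Def. 3.1 and Thm. 3.3] -/
theorem exists_regular_host_generator {𝓗 C : X.IdealSheafData} (h𝓗 : IsEffectiveCartier 𝓗) {η z : X}
    (hηz : η ⤳ z) [IsRegularLocalRing (X.presheaf.stalk z)] [IsRegularLocalRing (X.presheaf.stalk η)]
    (hCz : stalkIdeal C z = primeOfSpecializes hηz)
    (hperm : ((stalkIdeal C z).map
      (Ideal.Quotient.mk (stalkIdeal (vanishingIdeal 𝓗.support) z))).IsPermissible)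
    (hηH : η ∈ 𝓗.support) (hord : idealOrder 𝓗 η ≤ 1) :
    ∃ h : X.presheaf.stalk z, stalkIdeal 𝓗 z = Ideal.span {h} ∧ h ∈ stalkIdeal C z ∧
      h ∉ maximalIdeal (X.presheaf.stalk z) ^ 2 := by
  obtain ⟨g, -, hg⟩ := h𝓗.exists_stalkIdeal_eq_span z
  rw [vanishingIdeal_support] at hperm
  have hord' : ¬ stalkIdeal 𝓗 η ≤ maximalIdeal (X.presheaf.stalk η) ^ 2 := fun hle =>
    absurd (((le_idealOrder_iff 𝓗 η 2).mpr hle).trans hord) (by decide)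
  obtain ⟨hsq, hle⟩ := not_stalkIdeal_le_sq_of_isPermissible hηz ⟨g, hg⟩ hCz hperm hηH hord'
  refine ⟨g, hg, hle (hg ▸ Ideal.mem_span_singleton_self g), fun hg2 => hsq ?_⟩
  rw [hg, Ideal.span_singleton_le_iff_mem]
  exact hg2

end WeightTwoB

end Summit.ResolutionOfSingularities.ResolutionOfSingularities.Theorems

end
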